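import Summits.HubbardSuperconductivity.HubbardSuperconductivity.Theses.JosephsonMirror
import Summits.HubbardSuperconductivity.HubbardSuperconductivity.Theorems.JosephsonMirrorJmInterchangeExactResidues

/-!
# Split D1 of crux `JmInterchange` (stmt-HubbardSuperconductivity-2227) — route-context elaboration check (strategist s1; published as Cruxes/JmInterchange/SplitD1Check.lean)

The two children statements exactly as they will be handed to `ledger route edit --split JmInterchange --into children.json`,
elaborated with ONLY the `open`s of the gate-rendered route file `Theses/JosephsonMirror.lean` (no `QuantumLattice` open), and the
glue `JmZepoReachesFloor → JmFloorOrderBridges → JmInterchange` closed by the landed exact-residue theorem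
`jmInterchange_iff_reachesFloor_and_bridges` (p127245) — definitional unfolding only.
-/

namespace Summit.HubbardSuperconductivity.HubbardSuperconductivity.Theses.JosephsonMirrorSplitCheck

open scoped BigOperators Topology Manifold Classical MeasureTheory ProbabilityTheory Matrix InnerProductSpace ComplexConjugate ContinuousMap
open Filter Set Function TopologicalSpace MeasureTheory

open Literature.Hubbard
open Summit.HubbardSuperconductivity.HubbardSuperconductivity.Theses.JosephsonMirror (JmInterchange)

/-- child 1 (R1): zero-excess `d`-wave pair order reaches the ground floor, at every `(U, δ)`. -/
def JmZepoReachesFloor : Prop :=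
  ∀ (U δ : ℝ), 0 < U → δ ∈ Set.Ioo (0:ℝ) (1 / 2) → (∃ c : ℝ, 0 < c ∧ ∀ ε : ℝ, 0 < ε → ∃ L₀ : ℕ, ∀ (L : ℕ) [NeZero L], Even L → L₀ ≤ L → ∃ n : ℕ, (n = (2 * ⌊(1 - δ) * (L : ℝ) ^ 2 / 2⌋₊) ∨ n = (2 * ⌊(1 - δ) * (L : ℝ) ^ 2 / 2⌋₊) - 2) ∧ ∃ v : Literature.MathematicalPhysics.QuantumLattice.Fock (Literature.MathematicalPhysics.QuantumLattice.Orb (Literature.MathematicalPhysics.QuantumLattice.FermionTorus 2 L)), v ∈ Literature.MathematicalPhysics.QuantumLattice.szSector n 0 ∧ star v ⬝ᵥ v = 1 ∧ (star v ⬝ᵥ (Literature.MathematicalPhysics.QuantumLattice.hubbardTorus 2 L 1 U *ᵥ v)).re ≤ (Literature.MathematicalPhysics.QuantumLattice.hubbardTorus 2 L 1 U).minEnergyOn (Literature.MathematicalPhysics.QuantumLattice.szSector n 0) + ε * (L : ℝ) ^ 2 ∧ c * (L : ℝ) ^ 4 ≤ (star (Literature.MathematicalPhysics.QuantumLattice.pairField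 Literature.MathematicalPhysics.QuantumLattice.dWaveFormFactor L *ᵥ v) ⬝ᵥ (Literature.MathematicalPhysics.QuantumLattice.pairField Literature.MathematicalPhysics.QuantumLattice.dWaveFormFactor L *ᵥ v)).re) → ∃ c : ℝ, 0 < c ∧ ∃ L₀ : ℕ, ∀ (L : ℕ) [NeZero L], Even L → L₀ ≤ L → ∃ g : Literature.MathematicalPhysics.QuantumLattice.Fock (Literature.MathematicalPhysics.QuantumLattice.Orb (Literature.MathematicalPhysics.QuantumLattice.FermionTorus 2 L)), Literature.MathematicalPhysics.QuantumLattice.IsGroundStateInSector (Literature.MathematicalPhysics.QuantumLattice.hubbardTorus 2 L 1 U) (2 * ⌊(1 - δ) * (L : ℝ) ^ 2 / 2⌋₊) 0 g ∧ star g ⬝ᵥ g = 1 ∧ c * (L : ℝ) ^ 4 ≤ (star (Literature.MathematicalPhysics.QuantumLattice.pairField Literature.MathematicalPhysics.QuantumLattice.dWaveFormFactor L *ᵥ g) ⬝ᵥ (Literature.MathematicalPhysics.QuantumLattice.pairField Literature.MathematicalPhysics.QuantumLattice.dWaveFormFactor L *ᵥ g)).re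

/-- child 2 (R2′): floor order is `Δ_d`-connected to the adjacent floor, at every `(U, δ)`. -/
def JmFloorOrderBridges : Prop :=
  ∀ (U δ : ℝ), 0 < U → δ ∈ Set.Ioo (0:ℝ) (1 / 2) → (∃ c : ℝ, 0 < c ∧ ∃ L₀ : ℕ, ∀ (L : ℕ) [NeZero L], Even L → L₀ ≤ L → ∃ g : Literature.MathematicalPhysics.QuantumLattice.Fock (Literature.MathematicalPhysics.QuantumLattice.Orb (Literature.MathematicalPhysics.QuantumLattice.FermionTorus 2 L)), Literature.MathematicalPhysics.QuantumLattice.IsGroundStateInSector (Literature.MathematicalPhysics.QuantumLattice.hubbardTorus 2 L 1 U) (2 * ⌊(1 - δ) * (L : ℝ) ^ 2 / 2⌋₊) 0 g ∧ star g ⬝ᵥ g = 1 ∧ c * (L : ℝ) ^ 4 ≤ (star (Literature.MathematicalPhysics.QuantumLattice.pairField Literature.MathematicalPhysics.QuantumLattice.dWaveFormFactor L *ᵥ g) ⬝ᵥ (Literature.MathematicalPhysics.QuantumLattice.pairField Literature.MathematicalPhysics.QuantumLattice.dWaveFormFactor L *ᵥ g)).re) → ∃ a' : ℝ, 0 < a'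 ∧ ∃ L₀ : ℕ, ∀ (L : ℕ) [NeZero L], Even L → L₀ ≤ L → ∃ φ χ : Literature.MathematicalPhysics.QuantumLattice.Fock (Literature.MathematicalPhysics.QuantumLattice.Orb (Literature.MathematicalPhysics.QuantumLattice.FermionTorus 2 L)), Literature.MathematicalPhysics.QuantumLattice.IsGroundStateInSector (Literature.MathematicalPhysics.QuantumLattice.hubbardTorus 2 L 1 U) (2 * ⌊(1 - δ) * (L : ℝ) ^ 2 / 2⌋₊) 0 φ ∧ star φ ⬝ᵥ φ = 1 ∧ Literature.MathematicalPhysics.QuantumLattice.IsGroundStateInSector (Literature.MathematicalPhysics.QuantumLattice.hubbardTorus 2 L 1 U) (2 * ⌊(1 - δ) * (L : ℝ) ^ 2 / 2⌋₊ - 2) 0 χ ∧ star χ ⬝ᵥ χ = 1 ∧ a' * (L : ℝ) ^ 4 ≤ ‖star χ ⬝ᵥ Matrix.mulVec (Literature.MathematicalPhysics.QuantumLattice.pairField Literature.MathematicalPhysics.QuantumLattice.dWaveFormFactor L) φ‖ ^ 2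

/-- the glue, closed by p127245 (definitional unfolding of the two children). -/
theorem jmInterchange_of_children : JmZepoReachesFloor → JmFloorOrderBridges → JmInterchange :=
  fun h₁ h₂ =>
    Summit.HubbardSuperconductivity.HubbardSuperconductivity.Theorems.JosephsonMirror.jmInterchange_iff_reachesFloor_and_bridges.mpr
      ⟨h₁, h₂⟩

/-- and both children are NECESSARY (the split loses nothing). -/
theorem children_of_jmInterchange : JmInterchange → JmZepoReachesFloor ∧ JmFloorOrderBridges :=
  fun h =>
    Summit.HubbardSuperconductivity.HubbardSuperconductivity.Theorems.JosephsonMirror.jmInterchange_iff_reachesFloor_and_bridges.mp h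

end Summit.HubbardSuperconductivity.HubbardSuperconductivity.Theses.JosephsonMirrorSplitCheck
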